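import Mathlib
import Summits.NavierStokesRegularity.NavierStokesRegularity.Theorems.ThreadingFluxAzimuthalCartanConicalLandau
import Summits.NavierStokesRegularity.NavierStokesRegularity.Theorems.ThreadingFluxAzimuthalCartanConicalShellLandau
import HarnessLib

/-!
# Crux `PoloidalLiouville` (stmt-NavierStokesRegularity-1222, wall W1), crux idea «azimuthal-cartan-test» (ns-idea-15 g10):
# LIOUVILLE CONE DATA ON THE WHOLE PUNCTURED SPACE ARE EXACTLY THE MÖBIUS DATA (one axis, one parameter, globally)

Support file (`--supports stmt-NavierStokesRegularity-1222`, helper; cell `ns-wall-extremal`, width hand ns-wall-eng-6 g6, 0 kit).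

`…ConicalLandau.lean` (Λ1): the Möbius potential `LandauCone.potential a A` IS Liouville data on `ℝ³ ∖ {0}` and its conical flow IS
`landauAxisField a A`.  `…ConicalShellLandau.lean` (Λ2): Liouville data containing a full shell about the vertex are, ON THAT SHELL, trivial or
Möbius (`LiouvilleCone.moebius_of_shell`, Šverák's theorem read back through the correspondence).  THIS FILE patches the shells: for data on
the WHOLE punctured space the axis and the parameter do not depend on the shell —

* ★★ `LiouvilleCone.moebius_of_punctured_space` — `LiouvilleCone {x | x ≠ 0} Φ g H` ⇒ EITHER `Φ ≡ 0` and `conicalField Φ ≡ 0` on `ℝ³ ∖ {0}`,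
  OR there are ONE unit axis `a` and ONE `A > 1` with `Φ = LandauCone.potential a A` and `conicalField Φ = landauAxisField a A` on all of
  `ℝ³ ∖ {0}` (analytic continuation from the shell `1 < |x| < 2` across the preconnected `ℝ³ ∖ {0}`, tree `Sverak2011.isPreconnected_compl_zero`;
  the flow is read off `Φ` pointwise-and-locally: `u = ∇Φ + ((2e^{Φ} − 2)/|x|²) x`).

Together with (Λ1) this is an `↔`: the image of the conical correspondence on the whole punctured space is {0} ∪ {Landau solutions}, i.e. the
`0`-homogeneous real-analytic solutions of `|x|²ΔΦ + 2e^{Φ} − 2 = 0` on `ℝ³ ∖ {0}` are `Φ ≡ 0` and the Möbius potentials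
`log((A² − 1)|x|²/(A|x| − ⟪a, x⟫)²)` — the classification of whole-sphere solutions of Liouville's equation, in the kernel, via Navier–Stokes.

HONEST FRAME: placement information strictly below W1; closes no crux; `PoloidalLiouville` (1222), C♯ off the homogeneous stratum and NS
regularity are OPEN / NOT proved; 0 kit.
-/

-- the summit and its single sub-problem share the name (CONVENTIONS §1)
set_option linter.dupNamespace false

noncomputable section

namespace Summit.NavierStokesRegularity.NavierStokesRegularity.Theorems.PoloidalLiouville.AzimuthalCartan

open Set Function Filter Topology Metric
open scoped ContDiff RealInnerProductSpace
open Literature.Analysis.FluidPDE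
open Summit.NavierStokesRegularity.NavierStokesRegularity.Theorems.PoloidalLiouville.CentreJet (E3)

/-! ### The test shell and two local tools -/

/-- The test shell `1 < |x| < 2` lies in the punctured space. -/
theorem shell_one_two_subset : shell (0 : E3) 1 2 ⊆ {x : E3 | x ≠ 0} := fun _ hx => ne_zero_of_mem_shell_zero one_pos hx

/-- A point of the test shell: `(3/2) e₀`. -/
theorem mem_shell_one_two : ((3 / 2 : ℝ) • EuclideanSpace.single 0 1 : E3) ∈ shell (0 : E3) 1 2 := by
  rw [Homogeneous.mem_shell_zero, norm_smul, Real.norm_of_nonneg (by norm_num : (0 : ℝ) ≤ 3 / 2)]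
  simp only [PiLp.norm_single, norm_one, mul_one]
  norm_num

/-- The conical flow at `x` is determined by `Φ` near `x`: `Φ =ᶠ Ψ` near `x` ⇒ `conicalField Φ x = conicalField Ψ x`. -/
theorem conicalField_congr {Φ Ψ : E3 → ℝ} {x : E3} (h : Φ =ᶠ[𝓝 x] Ψ) : conicalField Φ x = conicalField Ψ x := by
  rw [conicalField, conicalField, h.gradient_eq, radialCoeff, radialCoeff, h.self_of_nhds]

namespace LiouvilleCone

variable {Φ : E3 → ℝ} {g : E3 → E3} {H : E3 → E3 →L[ℝ] E3} (hc : LiouvilleCone {x : E3 | x ≠ 0} Φ g H)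
include hc

/-- Analytic continuation of an identity `Φ = Ψ` from the test shell to the whole (preconnected) punctured space. -/
theorem eqOn_of_eqOn_shell {Ψ : E3 → ℝ} (hΨ : AnalyticOnNhd ℝ Ψ {x : E3 | x ≠ 0}) (h : EqOn Φ Ψ (shell (0 : E3) 1 2)) :
    EqOn Φ Ψ {x : E3 | x ≠ 0} := by
  have hev : Φ =ᶠ[𝓝 ((3 / 2 : ℝ) • EuclideanSpace.single 0 1 : E3)] Ψ := by
    filter_upwards [(isOpen_shell (0 : E3) 1 2).mem_nhds mem_shell_one_two] with y hy using h hy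
  exact hc.analyticOnNhd.eqOn_of_preconnected_of_eventuallyEq hΨ Sverak2011.isPreconnected_compl_zero
    (shell_one_two_subset mem_shell_one_two) hev

/-- ★★ **LIOUVILLE DATA ON THE WHOLE PUNCTURED SPACE ARE TRIVIAL OR MÖBIUS, GLOBALLY.**  For `LiouvilleCone {x ≠ 0} Φ g H`: EITHER `Φ ≡ 0` and
the conical flow vanishes on `ℝ³ ∖ {0}`, OR for ONE unit axis `a` and ONE parameter `A > 1`, `Φ = LandauCone.potential a A` and
`conicalField Φ = landauAxisField a A` on all of `ℝ³ ∖ {0}`. -/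
theorem moebius_of_punctured_space :
    (∀ x : E3, x ≠ 0 → Φ x = 0 ∧ conicalField Φ x = 0) ∨
      ∃ a : E3, ‖a‖ = 1 ∧ ∃ A : ℝ, 1 < A ∧ ∀ x : E3, x ≠ 0 →
        Φ x = LandauCone.potential a A x ∧ conicalField Φ x = landauAxisField a A x := by
  rcases hc.moebius_of_shell one_pos one_lt_two shell_one_two_subset with h0 | ⟨a, ha, A, hA, hL⟩
  · left
    -- `Φ ≡ 0` on the test shell, hence on the punctured space; then `∇Φ = 0`, `e^{Φ} = 1`, `u = 0`
    have hΦ : EqOn Φ (fun _ => (0 : ℝ)) {x : E3 | x ≠ 0} := hc.eqOn_of_eqOn_shell analyticOnNhd_const fun y hy => (h0 y hy).1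
    intro x hx
    have hev : Φ =ᶠ[𝓝 x] fun _ => (0 : ℝ) := by
      filter_upwards [isOpen_ne.mem_nhds hx] with y hy using hΦ hy
    refine ⟨hΦ hx, ?_⟩
    rw [conicalField_congr hev, conicalField, radialCoeff]
    simp
  · right
    have hΦ : EqOn Φ (LandauCone.potential a A) {x : E3 | x ≠ 0} :=
      hc.eqOn_of_eqOn_shell (fun y hy => LandauCone.analyticAt_potential ha hA hy) fun y hy => (hL y hy).1
    refine ⟨a, ha, A, hA, fun x hx => ⟨hΦ hx, ?_⟩⟩
    have hev : Φ =ᶠ[𝓝 x] LandauCone.potential a A := by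
      filter_upwards [isOpen_ne.mem_nhds hx] with y hy using hΦ hy
    rw [conicalField_congr hev, LandauCone.conicalField_eq_landauAxisField ha hA hx]

/-- ★ The same read as a classification of the POTENTIALS alone: a `0`-homogeneous real-analytic solution of `|x|²ΔΦ + 2e^{Φ} − 2 = 0` on
`ℝ³ ∖ {0}` (i.e. a whole-sphere solution of Liouville's equation `−Δ_{S²}φ + 2 = 2e^{φ}`) is `Φ ≡ 0` or a Möbius potential
`log ((A² − 1)|x|²/(A|x| − ⟪a, x⟫)²)`. -/
theorem potential_classification :
    (∀ x : E3, x ≠ 0 → Φ x = 0) ∨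
      ∃ a : E3, ‖a‖ = 1 ∧ ∃ A : ℝ, 1 < A ∧ ∀ x : E3, x ≠ 0 → Φ x = Real.log ((A ^ 2 - 1) * ‖x‖ ^ 2 / (A * ‖x‖ - ⟪a, x⟫) ^ 2) := by
  rcases hc.moebius_of_punctured_space with h | ⟨a, ha, A, hA, h⟩
  · exact Or.inl fun x hx => (h x hx).1
  · exact Or.inr ⟨a, ha, A, hA, fun x hx => (h x hx).1⟩

end LiouvilleCone

end Summit.NavierStokesRegularity.NavierStokesRegularity.Theorems.PoloidalLiouville.AzimuthalCartan

end
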